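import Summits.Ventures.PercRepro.C041FiveExitZone
import Summits.Ventures.PercRepro.C041TwoExitCount

/-!
# ROW C-041 — THE FIVE-EXIT ATTACHMENT: the anchor classes as conditions on the sextuple (p6, gen 31; groundwork
for r = 5, step (2) of the recipe — the same shape as `C041FourExitCount`)

`stateEquiv5`, **`fibCond5`**, `mem_Fset_iff5` … `mem_IBset_iff5`, `fib5`, `mem_fib5`; the 203 status patterns
(`genr.py 5`), their membership forms, counts and the assembly are the generators' (gen4mem.py / gen4count.py /
gen4main.py generalised to five exits).
-/

namespace PercRepro

namespace ZoneZ

namespace TwoExit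

open ZoneData Pendant AnchorGlue Finset

variable {V₁ E₁ U₁ U₂ V E T₁ T₂ V' E' T₁' T₂' V'' E'' T₁'' T₂'' V''' E''' T₁''' T₂''' V'''' E'''' T₁'''' T₂'''' : Type}
variable (Z₁ : ZoneData V₁ E₁ U₁ U₂) (u u' u'' u''' u'''' : V₁) (Z : ZoneData V E T₁ T₂) (a : V)
  (Z' : ZoneData V' E' T₁' T₂') (a' : V') (Z'' : ZoneData V'' E'' T₁'' T₂'') (a'' : V'')
  (Z''' : ZoneData V''' E''' T₁''' T₂''') (a''' : V''') (Z'''' : ZoneData V'''' E'''' T₁'''' T₂'''') (a'''' : V'''')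
  (a₁ : V₁)

/-- The states of the five-exit attachment: a colouring of `Z₁` and the states of the five zones. -/
def stateEquiv5 :
    State (((((E₁ ⊕ E') ⊕ E) ⊕ E'') ⊕ E''') ⊕ E'''') ((((T₁' ⊕ T₁) ⊕ T₁'') ⊕ T₁''') ⊕ T₁'''')
        ((((T₂' ⊕ T₂) ⊕ T₂'') ⊕ T₂''') ⊕ T₂'''') ≃
      (E₁ → Bool) × State E' T₁' T₂' × State E T₁ T₂ × State E'' T₁'' T₂'' × State E''' T₁''' T₂''' ×
        State E'''' T₁'''' T₂'''' where
  toFun σ := (col₁₅ σ, st'₅ σ, st₅ σ, st''₅ σ, st'''₅ σ, st''''₅ σ)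
  invFun p := (Sum.elim (Sum.elim (Sum.elim (Sum.elim (Sum.elim p.1 p.2.1.1) p.2.2.1.1) p.2.2.2.1.1) p.2.2.2.2.1.1)
      p.2.2.2.2.2.1,
    Sum.elim (Sum.elim (Sum.elim (Sum.elim p.2.1.2.1 p.2.2.1.2.1) p.2.2.2.1.2.1) p.2.2.2.2.1.2.1) p.2.2.2.2.2.2.1,
    Sum.elim (Sum.elim (Sum.elim (Sum.elim p.2.1.2.2 p.2.2.1.2.2) p.2.2.2.1.2.2) p.2.2.2.2.1.2.2) p.2.2.2.2.2.2.2)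
  left_inv σ := by
    obtain ⟨c, m₁, m₂⟩ := σ
    refine Prod.ext ?_ (Prod.ext ?_ ?_)
    · funext e
      rcases e with ((((e | e) | e) | e) | e) | e <;> rfl
    · funext t
      rcases t with (((t | t) | t) | t) | t <;> rfl
    · funext t
      rcases t with (((t | t) | t) | t) | t <;> rfl
  right_inv p := by
    obtain ⟨ω, ⟨c', m₁', m₂'⟩, ⟨c, m₁, m₂⟩, ⟨c'', m₁'', m₂''⟩, ⟨c''', m₁''', m₂'''⟩, ⟨c'''', m₁'''', m₂''''⟩⟩ := p
    rfl

/-- The equivalence, applied. -/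
theorem stateEquiv5_apply
    (σ : State (((((E₁ ⊕ E') ⊕ E) ⊕ E'') ⊕ E''') ⊕ E'''') ((((T₁' ⊕ T₁) ⊕ T₁'') ⊕ T₁''') ⊕ T₁'''')
      ((((T₂' ⊕ T₂) ⊕ T₂'') ⊕ T₂''') ⊕ T₂'''')) :
    stateEquiv5 σ = (col₁₅ σ, st'₅ σ, st₅ σ, st''₅ σ, st'''₅ σ, st''''₅ σ) := rfl

/-- The condition on a colouring `ω` of `Z₁` and states of the five zones for the corresponding state of the
five-exit attachment to lie in the anchor class `(c1, c2, k)` (`C041FiveExitZone`). -/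
def fibCond5 (ω : E₁ → Bool) (c1 c2 k : Bool) (τ' : State E' T₁' T₂') (τ : State E T₁ T₂)
    (τ'' : State E'' T₁'' T₂'') (τ''' : State E''' T₁''' T₂''') (τ'''' : State E'''' T₁'''' T₂'''') : Prop :=
  Z'.adm τ' ∧ Z.adm τ ∧ Z''.adm τ'' ∧ Z'''.adm τ''' ∧ Z''''.adm τ'''' ∧
    ¬ (((a' ∈ Z'.D τ' ∧ Z₁.Mg u u' ω) ∨ a ∈ Z.D τ) ∧ ((a' ∈ Z'.D2 τ' ∧ Z₁.Mg u u' ω) ∨ a ∈ Z.D2 τ)) ∧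
    ¬ (((a' ∈ Z'.D τ' ∧ Z₁.Mg u'' u' ω) ∨ (a ∈ Z.D τ ∧ Z₁.Mg u'' u ω) ∨ a'' ∈ Z''.D τ'') ∧
      ((a' ∈ Z'.D2 τ' ∧ Z₁.Mg u'' u' ω) ∨ (a ∈ Z.D2 τ ∧ Z₁.Mg u'' u ω) ∨ a'' ∈ Z''.D2 τ'')) ∧
    ¬ (((a' ∈ Z'.D τ' ∧ Z₁.Mg u''' u' ω) ∨ (a ∈ Z.D τ ∧ Z₁.Mg u''' u ω) ∨ (a'' ∈ Z''.D τ'' ∧ Z₁.Mg u''' u'' ω) ∨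
        a''' ∈ Z'''.D τ''') ∧
      ((a' ∈ Z'.D2 τ' ∧ Z₁.Mg u''' u' ω) ∨ (a ∈ Z.D2 τ ∧ Z₁.Mg u''' u ω) ∨ (a'' ∈ Z''.D2 τ'' ∧ Z₁.Mg u''' u'' ω) ∨
        a''' ∈ Z'''.D2 τ''')) ∧
    ¬ (((a' ∈ Z'.D τ' ∧ Z₁.Mg u'''' u' ω) ∨ (a ∈ Z.D τ ∧ Z₁.Mg u'''' u ω) ∨ (a'' ∈ Z''.D τ'' ∧ Z₁.Mg u'''' u'' ω) ∨
        (a''' ∈ Z'''.D τ''' ∧ Z₁.Mg u'''' u''' ω) ∨ a'''' ∈ Z''''.D τ'''') ∧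
      ((a' ∈ Z'.D2 τ' ∧ Z₁.Mg u'''' u' ω) ∨ (a ∈ Z.D2 τ ∧ Z₁.Mg u'''' u ω) ∨ (a'' ∈ Z''.D2 τ'' ∧ Z₁.Mg u'''' u'' ω) ∨
        (a''' ∈ Z'''.D2 τ''' ∧ Z₁.Mg u'''' u''' ω) ∨ a'''' ∈ Z''''.D2 τ'''')) ∧
    (c1 = true → ¬ ((a' ∈ Z'.D τ' ∧ Z₁.Mg a₁ u' ω) ∨ (a ∈ Z.D τ ∧ Z₁.Mg a₁ u ω) ∨
      (a'' ∈ Z''.D τ'' ∧ Z₁.Mg a₁ u'' ω) ∨ (a''' ∈ Z'''.D τ''' ∧ Z₁.Mg a₁ u''' ω) ∨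
      (a'''' ∈ Z''''.D τ'''' ∧ Z₁.Mg a₁ u'''' ω))) ∧
    (c2 = true → ¬ ((a' ∈ Z'.D2 τ' ∧ Z₁.Mg a₁ u' ω) ∨ (a ∈ Z.D2 τ ∧ Z₁.Mg a₁ u ω) ∨
      (a'' ∈ Z''.D2 τ'' ∧ Z₁.Mg a₁ u'' ω) ∨ (a''' ∈ Z'''.D2 τ''' ∧ Z₁.Mg a₁ u''' ω) ∨
      (a'''' ∈ Z''''.D2 τ'''' ∧ Z₁.Mg a₁ u'''' ω))) ∧
    (k = true → ((Z₁.Rd a₁ u' ω → Z'.blueK {a'} τ') ∧ (Z₁.Rd a₁ u ω → Z.blueK {a} τ) ∧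
      (Z₁.Rd a₁ u'' ω → Z''.blueK {a''} τ'') ∧ (Z₁.Rd a₁ u''' ω → Z'''.blueK {a'''} τ''') ∧
      (Z₁.Rd a₁ u'''' ω → Z''''.blueK {a''''} τ'''')))

section Counts

variable [Fintype E₁] [DecidableEq E₁] [Fintype E] [DecidableEq E] [Fintype T₁] [DecidableEq T₁]
  [Fintype T₂] [DecidableEq T₂] [Fintype E'] [DecidableEq E'] [Fintype T₁'] [DecidableEq T₁']
  [Fintype T₂'] [DecidableEq T₂'] [Fintype E''] [DecidableEq E''] [Fintype T₁''] [DecidableEq T₁'']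
  [Fintype T₂''] [DecidableEq T₂''] [Fintype E'''] [DecidableEq E'''] [Fintype T₁'''] [DecidableEq T₁''']
  [Fintype T₂'''] [DecidableEq T₂'''] [Fintype E''''] [DecidableEq E''''] [Fintype T₁''''] [DecidableEq T₁'''']
  [Fintype T₂''''] [DecidableEq T₂'''']

variable (σ : State (((((E₁ ⊕ E') ⊕ E) ⊕ E'') ⊕ E''') ⊕ E'''') ((((T₁' ⊕ T₁) ⊕ T₁'') ⊕ T₁''') ⊕ T₁'''')
  ((((T₂' ⊕ T₂) ⊕ T₂'') ⊕ T₂''') ⊕ T₂''''))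

/-- `F`: the class `(T, T, F)`. -/
theorem mem_Fset_iff5 :
    σ ∈ (glue5 Z₁ u u' u'' u''' u'''' Z a Z' a' Z'' a'' Z''' a''' Z'''' a'''').Fset
        (Sum.inl (Sum.inl (Sum.inl (Sum.inl (Sum.inl a₁))))) ↔
      fibCond5 Z₁ u u' u'' u''' u'''' Z a Z' a' Z'' a'' Z''' a''' Z'''' a'''' a₁ (col₁₅ σ) true true false (st'₅ σ)
        (st₅ σ) (st''₅ σ) (st'''₅ σ) (st''''₅ σ) := by
  rw [mem_Fset, adm₅_iff, anchor₅_mem_D_iff, anchor₅_mem_D2_iff]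
  simp only [fibCond5, Bool.false_eq_true, false_implies, and_true, true_implies, and_assoc]

/-- `F + T₁`: the class `(F, T, F)`. -/
theorem mem_FAset_iff5 :
    σ ∈ (glue5 Z₁ u u' u'' u''' u'''' Z a Z' a' Z'' a'' Z''' a''' Z'''' a'''').FAset
        (Sum.inl (Sum.inl (Sum.inl (Sum.inl (Sum.inl a₁))))) ↔
      fibCond5 Z₁ u u' u'' u''' u'''' Z a Z' a' Z'' a'' Z''' a''' Z'''' a'''' a₁ (col₁₅ σ) false true false (st'₅ σ)
        (st₅ σ) (st''₅ σ) (st'''₅ σ) (st''''₅ σ) := by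
  rw [mem_FAset, adm₅_iff, anchor₅_mem_D2_iff]
  simp only [fibCond5, Bool.false_eq_true, false_implies, and_true, true_implies, true_and, and_assoc]

/-- `F + T₂`: the class `(T, F, F)`. -/
theorem mem_FBset_iff5 :
    σ ∈ (glue5 Z₁ u u' u'' u''' u'''' Z a Z' a' Z'' a'' Z''' a''' Z'''' a'''').FBset
        (Sum.inl (Sum.inl (Sum.inl (Sum.inl (Sum.inl a₁))))) ↔
      fibCond5 Z₁ u u' u'' u''' u'''' Z a Z' a' Z'' a'' Z''' a''' Z'''' a'''' a₁ (col₁₅ σ) true false false (st'₅ σ)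
        (st₅ σ) (st''₅ σ) (st'''₅ σ) (st''''₅ σ) := by
  rw [mem_FBset, adm₅_iff, anchor₅_mem_D_iff]
  simp only [fibCond5, Bool.false_eq_true, false_implies, and_true, true_implies, and_assoc]

/-- `I_F`: the class `(T, T, T)`. -/
theorem mem_IFset_iff5 :
    σ ∈ (glue5 Z₁ u u' u'' u''' u'''' Z a Z' a' Z'' a'' Z''' a''' Z'''' a'''').IFset
        (Sum.inl (Sum.inl (Sum.inl (Sum.inl (Sum.inl a₁))))) ↔
      fibCond5 Z₁ u u' u'' u''' u'''' Z a Z' a' Z'' a'' Z''' a''' Z'''' a'''' a₁ (col₁₅ σ) true true true (st'₅ σ)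
        (st₅ σ) (st''₅ σ) (st'''₅ σ) (st''''₅ σ) := by
  rw [mem_IFset, adm₅_iff, anchor₅_mem_D_iff, anchor₅_mem_D2_iff, blueK₅_iff]
  simp only [fibCond5, true_implies, and_assoc]
  tauto

/-- `I_F + I₁`: the class `(F, T, T)`. -/
theorem mem_IAset_iff5 :
    σ ∈ (glue5 Z₁ u u' u'' u''' u'''' Z a Z' a' Z'' a'' Z''' a''' Z'''' a'''').IAset
        (Sum.inl (Sum.inl (Sum.inl (Sum.inl (Sum.inl a₁))))) ↔
      fibCond5 Z₁ u u' u'' u''' u'''' Z a Z' a' Z'' a'' Z''' a''' Z'''' a'''' a₁ (col₁₅ σ) false true true (st'₅ σ)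
        (st₅ σ) (st''₅ σ) (st'''₅ σ) (st''''₅ σ) := by
  rw [mem_IAset, adm₅_iff, anchor₅_mem_D2_iff, blueK₅_iff]
  simp only [fibCond5, Bool.false_eq_true, false_implies, true_implies, true_and, and_assoc]
  tauto

/-- `I_F + I₂`: the class `(T, F, T)`. -/
theorem mem_IBset_iff5 :
    σ ∈ (glue5 Z₁ u u' u'' u''' u'''' Z a Z' a' Z'' a'' Z''' a''' Z'''' a'''').IBset
        (Sum.inl (Sum.inl (Sum.inl (Sum.inl (Sum.inl a₁))))) ↔
      fibCond5 Z₁ u u' u'' u''' u'''' Z a Z' a' Z'' a'' Z''' a''' Z'''' a'''' a₁ (col₁₅ σ) true false true (st'₅ σ)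
        (st₅ σ) (st''₅ σ) (st'''₅ σ) (st''''₅ σ) := by
  rw [mem_IBset, adm₅_iff, anchor₅_mem_D_iff, blueK₅_iff]
  simp only [fibCond5, Bool.false_eq_true, false_implies, true_implies, true_and, and_assoc]
  tauto

open Classical in
/-- The fibre of the class `(c1, c2, k)` over the colouring `ω`. -/
noncomputable def fib5 (ω : E₁ → Bool) (c1 c2 k : Bool) :
    Finset (State E' T₁' T₂' × State E T₁ T₂ × State E'' T₁'' T₂'' × State E''' T₁''' T₂''' ×
      State E'''' T₁'''' T₂'''') :=
  univ.filter fun p => fibCond5 Z₁ u u' u'' u''' u'''' Z a Z' a' Z'' a'' Z''' a''' Z'''' a'''' a₁ ω c1 c2 k p.1 p.2.1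
    p.2.2.1 p.2.2.2.1 p.2.2.2.2

omit [Fintype E₁] [DecidableEq E₁] in
/-- Membership in a fibre. -/
theorem mem_fib5 (ω : E₁ → Bool) (c1 c2 k : Bool)
    (p : State E' T₁' T₂' × State E T₁ T₂ × State E'' T₁'' T₂'' × State E''' T₁''' T₂''' ×
      State E'''' T₁'''' T₂'''') :
    p ∈ fib5 Z₁ u u' u'' u''' u'''' Z a Z' a' Z'' a'' Z''' a''' Z'''' a'''' a₁ ω c1 c2 k ↔
      fibCond5 Z₁ u u' u'' u''' u'''' Z a Z' a' Z'' a'' Z''' a''' Z'''' a'''' a₁ ω c1 c2 k p.1 p.2.1 p.2.2.1 p.2.2.2.1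
        p.2.2.2.2 := by
  classical
  unfold fib5
  rw [Finset.mem_filter]
  exact and_iff_right (Finset.mem_univ _)

end Counts

end TwoExit

end ZoneZ

end PercRepro
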